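import Summits.QuantumFields.YangMills.Theorems.BalabanUVNodesN16KingModelTwoRunHolderDerivDecay

/-!
# Route «BalabanUVNodes» (K3⁶ `SpineGivenEndpointR13SepCoPR`), DAG node N16 = NE3 — THE KING-MODEL RUNG OF NE3, (3.71) LINE 4 FOR THE
# BLOCK-AVERAGED TWO-RUN DISCREPANCY, PART 3: the derivative-Hölder quotient `|x − y|^{−α}(∂^η_μD(x) − ∂^η_μD(y))` of
# `D = φ_K^ψ − Q_nφ_{K+n}^ψ` in SUP NORM on Bałaban's volumes, with King's decay — ONE constant for all levels, all `n`, all volumes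

Cell `pub-ymgap`, seat `pub-ymgap-dag-n16-c` (R134 acceleration seat, strategy s1; HUMAN RULING D-0062; chair R424 venue), generation 10.
`--kind proof --supports stmt-QuantumFields-20509 --as helper` (K3⁶, dag-lead WORDS-142).  `bears_on: R4∕N16 · row «R2^ϱ, the unprinted core»`.

WHY THIS FILE.  PART 1 (`BalabanUVNodesN16KingModelTwoRunHolderDeriv`) proved, on EVERY volume, King's (3.71) line 4 for the block-averaged
two-run kernel discrepancy `D_b = ℋ_K(·, b) − Q_nℋ_{K+n}(·, b)` — the scalar template of node N16's THIRD conjunct in its Hölder form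
((1.36)₃ ∕ `CovRootHolder β`'s modulus of the covariant gradient).  THIS file sums it over the datum with King's exponential decay
(«combining our bounds with Theorem 3.3», p. 674) on Bałaban's volumes `M_μ = 2Lᵐ`: the SUP-NORM form with ONE level- and volume-free
constant — the companion of generation 7's value line (`N16KingModel.twoRun_minimiser_blockMean_le_sup`), generation 8's derivative
line (`N16KingModelDerivSup.twoRunDeriv_minimiser_blockMean_le_sup`) and value-Hölder line (`N16KingModelHolder.twoRunHolder_minimiser_
blockMean_le_sup`).  With it ALL FOUR printed lines of (3.71) hold in kernel, in sup norm with the geometric rate `θ = L^{−γ∕2}`, for the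
block-averaged two-run discrepancy of King's minimisers — the complete scalar template of the [B11] (8)–(10) ∕ [B8] (1.36) currency list
that `NE3EnergyRateWCov` ∕ `CovRootHolder β` read for Bałaban's covariant minimisers.

MECHANISM.  PART 2 (`BalabanUVNodesN16KingModelTwoRunHolderDerivDecay.twoRunHolderDeriv_kernel_blockMean_decay_le`) is the per-kernel bound
with EIGHT decay profiles (King's line 4 with Thm 3.3's decay at the pairs `(x, x + v)`, `(x + e_μ, x + e_μ + v)`; the mixed patch through
`holder_dkernel_decay_blocks` at `s = α + γ∕2`); here each profile is summed over the unit torus by `tdistT_sumBound` (`≤ K_d`), King's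
minimiser map is expanded in the datum (`N16KingModelDeriv.datum_expand`, twice), and the `K, n`-dependence of King's rate factor is removed
by n18-a's `N18KingModelScalesPair.fprop38Const_le_unif` (at `β = α + 1`) ∕ `sqrt_rate_le_unif`.

WHAT THIS FILE PROVES (kernel; theorems only — 0 `def`, 0 sorry):
* §1 ★ `twoRunHolderDeriv_minimiser_blockMean_le_l1` — EVERY volume, the `ℓ¹`-datum form of PART 1's kernel bound:
  `|ρ^{−α}·(∂^η_μD^ψ(x) − ∂^η_μD^ψ(x + v))| ≤ (C₅⁗ + 2H_{α+γ})·(L^{−γ})^k·Σ_b|ψ(b)|`.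
* §2 ★★ `twoRunHolderDeriv_minimiser_blockMean_le_sup` — for `d ≥ 1`, odd `L ≥ 2`, `a, m² > 0`, `0 < α`, `0 < γ`, `α + γ < 1` there are
  `δ, c, δ₁, c₁ > 0` (functions of `d, L, a, m², α, γ` only) such that for EVERY volume `P = (d, L, m, K)`, `K ≥ 1`, every `n ≥ 1`, every
  datum `|ψ| ≤ S`, all coarse `x, v` and `μ`, with `ρ = holdist L^K M x (x + v)`:
  `|ρ^{−α}·(∂^η_μD^ψ(x) − ∂^η_μD^ψ(x + v))| ≤ (4√(2c·C₅⁗)·K_d(δ∕2) + 4c₁·K_d(δ₁))·(L^{−γ∕2})^K·S` — UNCONDITIONAL, level- AND volume-free.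

READING FOR ROW N16 (a dictionary, NOT a decl): (1.36)₃ ∕ `CovRootHolder β`'s third member ↔ `|∂^ηD(x) − ∂^ηD(x+v)| ≤ C·ρ^α·θ^K·S`,
`θ = L^{−γ∕2} < 1` (abelian: `Ad = id`, `α` plays `β`).  NOT CARRIED: gauge, transport, covariant average, axial constraint; `β = 1`.

HONEST FRAMING.  A MODEL LAYER ([King1986] printed AND proved; kernel re-proof BY NAME from the tree's King files).  NOTHING of
[Balaban1985RegularSpaces] ∕ [Balaban1985Variational] is proved or discharged; N16 ∕ NE3 is NOT discharged (in-edges N05 — [B8] Thm 4 ∕ Prop 3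
at the pinned all-torus members — and N07 — [B11] Thm 1 (8)+(10) — remain hypotheses of the chain of record); COUNT UNMOVED; count-neutral;
one finite torus at a time — NOT ℝ⁴, NOT infinite volume, NOT OS, NOT a mass gap, NOT Clay.

Sources: C. King, *The U(1) Higgs model. I. The continuum limit*, Commun. Math. Phys. **102** (1986) 649–677 [King1986], Prop. 3.8
(3.71) p. 664 (line 4), (3.62) p. 663, Thm 3.3 (3.7)–(3.8) p. 658, Prop. 3.7 (3.65) p. 663, §4 pp. 672–674; T. Bałaban, *Regularity and
decay of lattice Green's functions*, Commun. Math. Phys. **89** (1983) 571–597 [Balaban1983RegularityDecay], Thm (1.10) p. 573.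
-/

set_option autoImplicit false

noncomputable section

open Real Finset
open scoped BigOperators

namespace Summit.QuantumFields.YangMills.BalabanUVNodes.N16KingModelHolderDerivSup

open Literature.MathematicalPhysics.QuantumFieldTheory.Balaban1983to89 (Params)
open Literature.MathematicalPhysics.QuantumFieldTheory.Balaban1983to89.B5Prop11Plancherel (Tor fine unitVec)
open Literature.MathematicalPhysics.QuantumFieldTheory.Balaban1983to89.B4Sect5Proof (latticeConst latticeConst_nonneg)
open Literature.MathematicalPhysics.QuantumFieldTheory.King1986
  (aK aK_pos aK_le lemma43Const fprop38RateConst fprop38PosConst aliasConst)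
open Literature.MathematicalPhysics.QuantumFieldTheory.King1986.Torus
  (minimiser blockOf tdistT tdistT_sumBound holdist)
open Summit.QuantumFields.YangMills.BalabanUVNodes.N18KingModel (rpow_neg_natPow kingTheta_pos)
open Summit.QuantumFields.YangMills.BalabanUVNodes.N18KingModelScalesPair
  (fprop38Const_le_unif sqrt_rate_le_unif aliasConst_nonneg_of_lt_one)
open Summit.QuantumFields.YangMills.BalabanUVNodes.N16KingModelDeriv (datum_expand)
open Summit.QuantumFields.YangMills.BalabanUVNodes.N16KingModelHolderDeriv (twoRunHolderDeriv_kernel_blockMean_le)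
open Summit.QuantumFields.YangMills.BalabanUVNodes.N16KingModelHolderDerivDecay (twoRunHolderDeriv_kernel_blockMean_decay_le)

variable {d : ℕ}

/-! ## §1 ★ EVERY VOLUME: the `ℓ¹`-datum form -/

section EveryVolume

variable {L : ℕ} [NeZero L] (M : Fin d → ℕ) [∀ μ, NeZero (M μ)]

/-- ★ **THE HÖLDER QUOTIENT OF THE LATTICE DERIVATIVE OF THE TWO-RUN MINIMISER DISCREPANCY AFTER BLOCK AVERAGING — DATUM FORM, EVERY
VOLUME**: for every datum `ψ` on the unit torus, coarse points `x, x + v` and direction `μ`, with `D^ψ = φ_k^ψ − Q_nφ_{k+n}^ψ`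
(`φ_k^ψ = minimiser Lᵏ M a_k (Lᵏ)² m² ψ`): `|ρ^{−α}·(∂^η_μD^ψ(x) − ∂^η_μD^ψ(x + v))| ≤ (C₅⁗ + 2H_{α+γ})·(L^{−γ})^k·Σ_b|ψ(b)|` — linearity in the
datum (`N16KingModelDeriv.datum_expand`) over `twoRunHolderDeriv_kernel_blockMean_le`.  The (1.36)₃ ∕ `CovRootHolder` third member IN KING's
MODEL, `ℓ¹`-datum form. [cite: King1986, Prop. 3.8 (3.71) p.664 (line 4), (2.13)–(2.15) p.653] -/
theorem twoRunHolderDeriv_minimiser_blockMean_le_l1 (hd : 0 < d) (hLodd : Odd L) (hL : 2 ≤ L) {k n : ℕ} (hk : 1 ≤ k)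
    (hn : 1 ≤ n) {a m2 : ℝ} (ha : 0 < a) (hm : 0 < m2) {α γ : ℝ} (hα : 0 ≤ α) (hγ : 0 < γ) (hαγ : α + γ < 1)
    (ψ : Tor M → ℝ) (x v : Tor (fine (L ^ k) M)) (μ : Fin d) :
    |(holdist (L ^ k) M x (x + v)) ^ (-α) *
        (((L ^ k : ℕ) : ℝ) *
          ((minimiser (L ^ k) M (aK a L k) (((L ^ k : ℕ) : ℝ) ^ 2) m2 ψ (x + unitVec (fine (L ^ k) M) μ)
              - (((Finset.univ.filter fun y : Tor (fine (L ^ n * L ^ k) M) =>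
                    ∀ ν, ((x + unitVec (fine (L ^ k) M) μ) ν).val = (y ν).val / L ^ n).card : ℝ))⁻¹ *
                ∑ y ∈ (Finset.univ.filter fun y : Tor (fine (L ^ n * L ^ k) M) =>
                    ∀ ν, ((x + unitVec (fine (L ^ k) M) μ) ν).val = (y ν).val / L ^ n),
                  minimiser (L ^ n * L ^ k) M (aK a L (k + n)) (((L ^ n * L ^ k : ℕ) : ℝ) ^ 2) m2 ψ y)
            - (minimiser (L ^ k) M (aK a L k) (((L ^ k : ℕ) : ℝ) ^ 2) m2 ψ x
              - (((Finset.univ.filter fun x' : Tor (fine (L ^ n * L ^ k) M) =>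
                    ∀ ν, (x ν).val = (x' ν).val / L ^ n).card : ℝ))⁻¹ *
                ∑ x' ∈ (Finset.univ.filter fun x' : Tor (fine (L ^ n * L ^ k) M) => ∀ ν, (x ν).val = (x' ν).val / L ^ n),
                  minimiser (L ^ n * L ^ k) M (aK a L (k + n)) (((L ^ n * L ^ k : ℕ) : ℝ) ^ 2) m2 ψ x'))
        - ((L ^ k : ℕ) : ℝ) *
          ((minimiser (L ^ k) M (aK a L k) (((L ^ k : ℕ) : ℝ) ^ 2) m2 ψ (x + v + unitVec (fine (L ^ k) M) μ)
              - (((Finset.univ.filter fun y : Tor (fine (L ^ n * L ^ k) M) =>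
                    ∀ ν, ((x + v + unitVec (fine (L ^ k) M) μ) ν).val = (y ν).val / L ^ n).card : ℝ))⁻¹ *
                ∑ y ∈ (Finset.univ.filter fun y : Tor (fine (L ^ n * L ^ k) M) =>
                    ∀ ν, ((x + v + unitVec (fine (L ^ k) M) μ) ν).val = (y ν).val / L ^ n),
                  minimiser (L ^ n * L ^ k) M (aK a L (k + n)) (((L ^ n * L ^ k : ℕ) : ℝ) ^ 2) m2 ψ y)
            - (minimiser (L ^ k) M (aK a L k) (((L ^ k : ℕ) : ℝ) ^ 2) m2 ψ (x + v)
              - (((Finset.univ.filter fun y : Tor (fine (L ^ n * L ^ k) M) =>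
                    ∀ ν, ((x + v) ν).val = (y ν).val / L ^ n).card : ℝ))⁻¹ *
                ∑ y ∈ (Finset.univ.filter fun y : Tor (fine (L ^ n * L ^ k) M) => ∀ ν, ((x + v) ν).val = (y ν).val / L ^ n),
                  minimiser (L ^ n * L ^ k) M (aK a L (k + n)) (((L ^ n * L ^ k : ℕ) : ℝ) ^ 2) m2 ψ y)))|
      ≤ ((fprop38RateConst a a (a * (2 * ((a * (1 - ((L : ℝ) ^ 2)⁻¹))⁻¹ + π ^ 2 / 48 + 1 / 3))) ((π ^ 2 / 4) ^ d) d γ (α + 1)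
              (2 * (d : ℝ) ^ α) (2 * (d : ℝ) ^ α * 2 ^ (1 - γ))
            + fprop38PosConst a ((π ^ 2 / 4) ^ d) d γ (α + 1) (2 * (d : ℝ) ^ α) (6 * (d : ℝ) ^ (α + γ)))
          + 2 * ((π / 2) ^ d * ((π ^ 2 / 4) ^ d * (π ^ 2 / 4) * (2 * (d : ℝ) ^ (α + γ) * π ^ (α + γ + 1))
            + a * (π ^ 2 / 4) * (2 * (d : ℝ) ^ (α + γ)) * aliasConst d (α + γ)))) * ((L : ℝ) ^ (-γ)) ^ k
        * ∑ b, |ψ b| := by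
  set C : ℝ := ((fprop38RateConst a a (a * (2 * ((a * (1 - ((L : ℝ) ^ 2)⁻¹))⁻¹ + π ^ 2 / 48 + 1 / 3))) ((π ^ 2 / 4) ^ d) d γ
              (α + 1) (2 * (d : ℝ) ^ α) (2 * (d : ℝ) ^ α * 2 ^ (1 - γ))
            + fprop38PosConst a ((π ^ 2 / 4) ^ d) d γ (α + 1) (2 * (d : ℝ) ^ α) (6 * (d : ℝ) ^ (α + γ)))
          + 2 * ((π / 2) ^ d * ((π ^ 2 / 4) ^ d * (π ^ 2 / 4) * (2 * (d : ℝ) ^ (α + γ) * π ^ (α + γ + 1))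
            + a * (π ^ 2 / 4) * (2 * (d : ℝ) ^ (α + γ)) * aliasConst d (α + γ)))) * ((L : ℝ) ^ (-γ)) ^ k with hC
  -- expand both derivative discrepancies in the datum and collect
  have hterm : ∀ (b : Tor M) (T1 T2 : ℝ), (holdist (L ^ k) M x (x + v)) ^ (-α) * (ψ b * T1 - ψ b * T2)
      = ψ b * ((holdist (L ^ k) M x (x + v)) ^ (-α) * (T1 - T2)) := by intros; ring
  rw [datum_expand, datum_expand, ← Finset.sum_sub_distrib, Finset.mul_sum]
  simp_rw [hterm]
  refine (Finset.abs_sum_le_sum_abs _ _).trans ?_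
  have hC : C * ∑ b, |ψ b| = ∑ b, |ψ b| * C := by
    rw [Finset.mul_sum]
    exact Finset.sum_congr rfl (fun _ _ => mul_comm _ _)
  rw [hC]
  refine Finset.sum_le_sum fun b _ => ?_
  rw [abs_mul]
  exact mul_le_mul_of_nonneg_left
    (twoRunHolderDeriv_kernel_blockMean_le M hd hLodd hL hk hn ha hm hα hγ hαγ b x v μ) (abs_nonneg _)

end EveryVolume

/-! ## §2 ★★ On Bałaban's volumes: the SUP-NORM derivative-Hölder quotient of the two-run discrepancy with King's decay -/

/-- ★★ **(1.36)₃ ∕ `CovRootHolder`'s THIRD MEMBER IN KING's MODEL, SUP-NORM FORM, UNCONDITIONAL** (King's Prop. 3.8 (3.71) line 4 «combined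
with Theorem 3.3», at the translated fine pairs read by the derivative of the block mean, averaged over the fibre and over `j < Lⁿ`, summed
over the unit torus).  For `d ≥ 1`, odd `L ≥ 2`, `a, m² > 0`, `0 < α`, `0 < γ`, `α + γ < 1` there are `δ, c, δ₁, c₁ > 0` (PART 2's, i.e. n18-b's
`king_prop38_holder_deriv_torus_blocks` ∕ `holder_dkernel_decay_blocks` at `s = α + γ∕2`), functions of
`d, L, a, m², α, γ` only, such that for EVERY volume `P = (d, L, m, K)` of the `B1∕B4` tower with `K ≥ 1` (unit torus `M_μ = 2Lᵐ`), every
`n ≥ 1`, every datum `ψ` with `|ψ| ≤ S`, all coarse points `x, x + v` and directions `μ`, with `ρ = holdist L^K M x (x + v)`,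
`D^ψ = φ_K^ψ − Q_nφ_{K+n}^ψ` and `∂^η_μg(z) = L^K·(g(z + e_μ) − g(z))`:
`|ρ^{−α}·(∂^η_μD^ψ(x) − ∂^η_μD^ψ(x + v))| ≤ (4√(2c·C₅⁗(a, L, d, γ, α))·K_d(δ∕2) + 4c₁·K_d(δ₁))·(L^{−γ∕2})^K·S`, `K_d = B4Sect5Proof.latticeConst d`.
The constant reads NEITHER the level `K` NOR `n` NOR the volume. [cite: King1986, Prop. 3.8 (3.71) p.664 (line 4), Thm 3.3 (3.8) p.658,
Prop. 3.7 (3.65) p.663, p.674; Balaban1983RegularityDecay, Thm (1.10) p.573] -/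
theorem twoRunHolderDeriv_minimiser_blockMean_le_sup (dd L : ℕ) (hd : 1 ≤ dd) (hLodd : Odd L) (hL : 2 ≤ L) {a m2 : ℝ}
    (ha : 0 < a) (hm : 0 < m2) {α γ : ℝ} (hα : 0 < α) (hγ : 0 < γ) (hαγ : α + γ < 1) :
    ∃ δ c δ₁ c₁ : ℝ, 0 < δ ∧ 0 < c ∧ 0 < δ₁ ∧ 0 < c₁ ∧
      ∀ (P : Params) (_hPd : P.d = dd) (_hPL : P.L = L) (_hK : 1 ≤ P.K) [NeZero P.L]
      (n : ℕ) (_hn : 1 ≤ n) (M : Fin P.d → ℕ) [∀ μ, NeZero (M μ)] (_hMK : ∀ μ, M μ = P.sitesPerDir P.K)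
      (ψ : Tor M → ℝ) (S : ℝ) (_hS : ∀ b, |ψ b| ≤ S) (xt v : Tor (fine (P.L ^ P.K) M)) (μ : Fin P.d),
      |(holdist (P.L ^ P.K) M xt (xt + v)) ^ (-α) *
          (((P.L ^ P.K : ℕ) : ℝ) *
            ((minimiser (P.L ^ P.K) M (aK a P.L P.K) (((P.L ^ P.K : ℕ) : ℝ) ^ 2) m2 ψ (xt + unitVec (fine (P.L ^ P.K) M) μ)
                - (((Finset.univ.filter fun y : Tor (fine (P.L ^ n * P.L ^ P.K) M) =>
                      ∀ ν, ((xt + unitVec (fine (P.L ^ P.K) M) μ) ν).val = (y ν).val / P.L ^ n).card : ℝ))⁻¹ *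
                  ∑ y ∈ (Finset.univ.filter fun y : Tor (fine (P.L ^ n * P.L ^ P.K) M) =>
                      ∀ ν, ((xt + unitVec (fine (P.L ^ P.K) M) μ) ν).val = (y ν).val / P.L ^ n),
                    minimiser (P.L ^ n * P.L ^ P.K) M (aK a P.L (P.K + n)) (((P.L ^ n * P.L ^ P.K : ℕ) : ℝ) ^ 2) m2 ψ y)
              - (minimiser (P.L ^ P.K) M (aK a P.L P.K) (((P.L ^ P.K : ℕ) : ℝ) ^ 2) m2 ψ xt
                - (((Finset.univ.filter fun x' : Tor (fine (P.L ^ n * P.L ^ P.K) M) =>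
                      ∀ ν, (xt ν).val = (x' ν).val / P.L ^ n).card : ℝ))⁻¹ *
                  ∑ x' ∈ (Finset.univ.filter fun x' : Tor (fine (P.L ^ n * P.L ^ P.K) M) =>
                      ∀ ν, (xt ν).val = (x' ν).val / P.L ^ n),
                    minimiser (P.L ^ n * P.L ^ P.K) M (aK a P.L (P.K + n)) (((P.L ^ n * P.L ^ P.K : ℕ) : ℝ) ^ 2) m2 ψ x'))
          - ((P.L ^ P.K : ℕ) : ℝ) *
            ((minimiser (P.L ^ P.K) M (aK a P.L P.K) (((P.L ^ P.K : ℕ) : ℝ) ^ 2) m2 ψ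
                  (xt + v + unitVec (fine (P.L ^ P.K) M) μ)
                - (((Finset.univ.filter fun y : Tor (fine (P.L ^ n * P.L ^ P.K) M) =>
                      ∀ ν, ((xt + v + unitVec (fine (P.L ^ P.K) M) μ) ν).val = (y ν).val / P.L ^ n).card : ℝ))⁻¹ *
                  ∑ y ∈ (Finset.univ.filter fun y : Tor (fine (P.L ^ n * P.L ^ P.K) M) =>
                      ∀ ν, ((xt + v + unitVec (fine (P.L ^ P.K) M) μ) ν).val = (y ν).val / P.L ^ n),
                    minimiser (P.L ^ n * P.L ^ P.K) M (aK a P.L (P.K + n)) (((P.L ^ n * P.L ^ P.K : ℕ) : ℝ) ^ 2) m2 ψ y)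
              - (minimiser (P.L ^ P.K) M (aK a P.L P.K) (((P.L ^ P.K : ℕ) : ℝ) ^ 2) m2 ψ (xt + v)
                - (((Finset.univ.filter fun y : Tor (fine (P.L ^ n * P.L ^ P.K) M) =>
                      ∀ ν, ((xt + v) ν).val = (y ν).val / P.L ^ n).card : ℝ))⁻¹ *
                  ∑ y ∈ (Finset.univ.filter fun y : Tor (fine (P.L ^ n * P.L ^ P.K) M) =>
                      ∀ ν, ((xt + v) ν).val = (y ν).val / P.L ^ n),
                    minimiser (P.L ^ n * P.L ^ P.K) M (aK a P.L (P.K + n)) (((P.L ^ n * P.L ^ P.K : ℕ) : ℝ) ^ 2) m2 ψ y)))|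
        ≤ (4 * Real.sqrt (2 * c *
                (fprop38RateConst a a (a * (2 * ((a * (1 - ((L : ℝ) ^ 2)⁻¹))⁻¹ + π ^ 2 / 48 + 1 / 3))) ((π ^ 2 / 4) ^ dd) dd γ
                    (α + 1) (2 * (dd : ℝ) ^ α) (2 * (dd : ℝ) ^ α * 2 ^ (1 - γ))
                  + fprop38PosConst a ((π ^ 2 / 4) ^ dd) dd γ (α + 1) (2 * (dd : ℝ) ^ α) (6 * (dd : ℝ) ^ (α + γ))))
              * latticeConst dd (δ / 2)
            + 4 * c₁ * latticeConst dd δ₁) * ((L : ℝ) ^ (-(γ / 2))) ^ P.K * S := by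
  obtain ⟨δ, c, δ₁, c₁, hδ, hc, hδ₁, hc₁, HD⟩ := twoRunHolderDeriv_kernel_blockMean_decay_le dd L hd hLodd hL ha hm hα hγ hαγ
  refine ⟨δ, c, δ₁, c₁, hδ, hc, hδ₁, hc₁, ?_⟩
  intro P hPd hPL hK _ n hn M _ hMK ψ S hS xt v μ
  have hker := fun bt : Tor M => HD P hPd hPL hK n hn M hMK bt xt v μ
  subst hPd hPL
  -- elementary facts
  have hd0 : 0 < P.d := by omega
  have hS0 : 0 ≤ S := (abs_nonneg _).trans (hS 0)
  have hAC' : 0 ≤ aliasConst P.d (α + 1 + γ - 1) := by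
    rw [show α + 1 + γ - 1 = α + γ by ring]; exact aliasConst_nonneg_of_lt_one hd0 hαγ
  have hCle := fprop38Const_le_unif (d := P.d) ha hL hK hn (V := (π ^ 2 / 4) ^ P.d) (γ := γ) (β := α + 1)
    (cE := 2 * (P.d : ℝ) ^ α) (rE := 2 * (P.d : ℝ) ^ α * 2 ^ (1 - γ)) (sE := 6 * (P.d : ℝ) ^ (α + γ)) (by positivity)
    (by positivity) hAC'
  -- names: King's rate factor, the patch rate, the decay profiles
  set Rk : ℝ := Real.sqrt ((fprop38RateConst a a (lemma43Const a P.L P.K n) ((π ^ 2 / 4) ^ P.d) P.d γ (α + 1)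
        (2 * (P.d : ℝ) ^ α) (2 * (P.d : ℝ) ^ α * 2 ^ (1 - γ))
      + fprop38PosConst a ((π ^ 2 / 4) ^ P.d) P.d γ (α + 1) (2 * (P.d : ℝ) ^ α) (6 * (P.d : ℝ) ^ (α + γ)))
      * ((P.L ^ P.K : ℕ) : ℝ) ^ (-γ) * (2 * c)) with hRk
  set ρr : ℝ := ((P.L ^ P.K : ℕ) : ℝ) ^ (-(γ / 2)) with hρr
  have hRk0 : 0 ≤ Rk := Real.sqrt_nonneg _
  have hρr0 : 0 ≤ ρr := Real.rpow_nonneg (Nat.cast_nonneg _) _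
  set E : Tor (fine (P.L ^ P.K) M) → Tor M → ℝ :=
    fun z bt => Real.exp (-(δ / 2 * tdistT M (blockOf (P.L ^ P.K) M z) bt)) with hE
  set E₁ : Tor (fine (P.L ^ P.K) M) → Tor M → ℝ :=
    fun z bt => Real.exp (-(δ₁ * tdistT M (blockOf (P.L ^ P.K) M z) bt)) with hE₁
  -- sum the eight decay profiles over the unit torus
  have hsum : ∀ z : Tor (fine (P.L ^ P.K) M), ∑ bt : Tor M, E z bt ≤ latticeConst P.d (δ / 2) := fun z =>
    tdistT_sumBound M (δ / 2) (by positivity) (blockOf (P.L ^ P.K) M z)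
  have hsum₁ : ∀ z : Tor (fine (P.L ^ P.K) M), ∑ bt : Tor M, E₁ z bt ≤ latticeConst P.d δ₁ := fun z =>
    tdistT_sumBound M δ₁ hδ₁ (blockOf (P.L ^ P.K) M z)
  have hβsum : ∑ bt : Tor M, (Rk * ((E xt bt + E (xt + v) bt)
        + (E (xt + unitVec (fine (P.L ^ P.K) M) μ) bt + E (xt + v + unitVec (fine (P.L ^ P.K) M) μ) bt))
        + c₁ * ρr * ((E₁ (xt + unitVec (fine (P.L ^ P.K) M) μ) bt + E₁ xt bt)
          + (E₁ (xt + v + unitVec (fine (P.L ^ P.K) M) μ) bt + E₁ (xt + v) bt)))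
      ≤ Rk * (4 * latticeConst P.d (δ / 2)) + c₁ * ρr * (4 * latticeConst P.d δ₁) := by
    rw [Finset.sum_add_distrib, ← Finset.mul_sum, ← Finset.mul_sum, Finset.sum_add_distrib, Finset.sum_add_distrib,
      Finset.sum_add_distrib, Finset.sum_add_distrib, Finset.sum_add_distrib, Finset.sum_add_distrib]
    have ha1 := hsum xt; have ha2 := hsum (xt + v); have ha3 := hsum (xt + unitVec (fine (P.L ^ P.K) M) μ)
    have ha4 := hsum (xt + v + unitVec (fine (P.L ^ P.K) M) μ)
    have hb1 := hsum₁ (xt + unitVec (fine (P.L ^ P.K) M) μ); have hb2 := hsum₁ xt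
    have hb3 := hsum₁ (xt + v + unitVec (fine (P.L ^ P.K) M) μ); have hb4 := hsum₁ (xt + v)
    have := mul_nonneg hc₁.le hρr0
    nlinarith
  -- the uniform rates
  have hRk_le : Rk ≤ Real.sqrt (2 * c *
        (fprop38RateConst a a (a * (2 * ((a * (1 - ((P.L : ℝ) ^ 2)⁻¹))⁻¹ + π ^ 2 / 48 + 1 / 3))) ((π ^ 2 / 4) ^ P.d) P.d γ
            (α + 1) (2 * (P.d : ℝ) ^ α) (2 * (P.d : ℝ) ^ α * 2 ^ (1 - γ))
          + fprop38PosConst a ((π ^ 2 / 4) ^ P.d) P.d γ (α + 1) (2 * (P.d : ℝ) ^ α) (6 * (P.d : ℝ) ^ (α + γ))))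
      * ((P.L : ℝ) ^ (-(γ / 2))) ^ P.K :=
    sqrt_rate_le_unif hCle (by positivity) P.L P.K γ
  have hρr_eq : ρr = ((P.L : ℝ) ^ (-(γ / 2))) ^ P.K := rpow_neg_natPow P.L P.K (γ / 2)
  -- expand in the datum and sum
  have hterm : ∀ (bt : Tor M) (T1 T2 : ℝ), (holdist (P.L ^ P.K) M xt (xt + v)) ^ (-α) * (ψ bt * T1 - ψ bt * T2)
      = ψ bt * ((holdist (P.L ^ P.K) M xt (xt + v)) ^ (-α) * (T1 - T2)) := by intros; ring
  rw [datum_expand, datum_expand, ← Finset.sum_sub_distrib, Finset.mul_sum]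
  simp_rw [hterm]
  refine (Finset.abs_sum_le_sum_abs _ _).trans ?_
  calc _ ≤ ∑ bt, S * (Rk * ((E xt bt + E (xt + v) bt)
          + (E (xt + unitVec (fine (P.L ^ P.K) M) μ) bt + E (xt + v + unitVec (fine (P.L ^ P.K) M) μ) bt))
          + c₁ * ρr * ((E₁ (xt + unitVec (fine (P.L ^ P.K) M) μ) bt + E₁ xt bt)
            + (E₁ (xt + v + unitVec (fine (P.L ^ P.K) M) μ) bt + E₁ (xt + v) bt))) := by
        refine Finset.sum_le_sum fun bt _ => ?_
        rw [abs_mul]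
        exact mul_le_mul (hS bt) (hker bt) (abs_nonneg _) hS0
    _ = S * ∑ bt, (Rk * ((E xt bt + E (xt + v) bt)
          + (E (xt + unitVec (fine (P.L ^ P.K) M) μ) bt + E (xt + v + unitVec (fine (P.L ^ P.K) M) μ) bt))
          + c₁ * ρr * ((E₁ (xt + unitVec (fine (P.L ^ P.K) M) μ) bt + E₁ xt bt)
            + (E₁ (xt + v + unitVec (fine (P.L ^ P.K) M) μ) bt + E₁ (xt + v) bt))) := by rw [Finset.mul_sum]
    _ ≤ S * (Rk * (4 * latticeConst P.d (δ / 2)) + c₁ * ρr * (4 * latticeConst P.d δ₁)) :=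
        mul_le_mul_of_nonneg_left hβsum hS0
    _ ≤ S * (Real.sqrt (2 * c *
          (fprop38RateConst a a (a * (2 * ((a * (1 - ((P.L : ℝ) ^ 2)⁻¹))⁻¹ + π ^ 2 / 48 + 1 / 3))) ((π ^ 2 / 4) ^ P.d) P.d γ
              (α + 1) (2 * (P.d : ℝ) ^ α) (2 * (P.d : ℝ) ^ α * 2 ^ (1 - γ))
            + fprop38PosConst a ((π ^ 2 / 4) ^ P.d) P.d γ (α + 1) (2 * (P.d : ℝ) ^ α) (6 * (P.d : ℝ) ^ (α + γ))))
          * ((P.L : ℝ) ^ (-(γ / 2))) ^ P.K * (4 * latticeConst P.d (δ / 2))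
          + c₁ * ((P.L : ℝ) ^ (-(γ / 2))) ^ P.K * (4 * latticeConst P.d δ₁)) := by
        rw [← hρr_eq] at hRk_le ⊢
        have hK0 : 0 ≤ 4 * latticeConst P.d (δ / 2) := by
          have := latticeConst_nonneg P.d (by positivity : (0 : ℝ) ≤ δ / 2); linarith
        exact mul_le_mul_of_nonneg_left (add_le_add (mul_le_mul_of_nonneg_right hRk_le hK0) le_rfl) hS0
    _ = _ := by ring

end Summit.QuantumFields.YangMills.BalabanUVNodes.N16KingModelHolderDerivSup

end
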